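import Mathlib
import Summits.MatrixMultiplication.MatrixMultiplication.Theorems.SubgroupIdentityDesigns.Negative.LevelCount

/-!
# The level-`k` character count is governed by Kronecker classes
# (support lemma for the crux `SubgroupIdentityDesigns`, stmt-MatrixMultiplication-14079; cell B2b-5
# `b2b-lgcu-borel`, gen 11 — report `run/shared/lean/b2b/levelgraded-cu/ORACLE-g11.md` §G11-5c)

Sharpening of `LevelCount.ncard_irr_level_le` (`#(Irr(GL_m(𝔽_p)) ∩ F_k) ≤ #{subspaces of 𝔽_p^{2k}}`,
a bound of order `p^{k²}`).  The conjugation-sum of a frame transport `[g U = A]` is ALSO blind to a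
simultaneous right twist `(U, A) ↦ (U y, A y)`, `y ∈ GL_k(𝔽_p)` (`transport_mul_right`), and the kernel
invariant transforms by `ker[U y | A y] = (y ⊕ y)⁻¹ ker[U | A]` (`ker_fromCols_mul`).  Hence

* `ncard_irr_level_le_classes` — **for every `m`, `#(Irr(GL_m(𝔽_p)) ∩ F_k)` is at most the number of
  classes of ANY classification `τ` of the subspaces `K ≤ 𝔽_p^k ⊕ 𝔽_p^k` that is complete for the
  diagonal action of `GL_k(𝔽_p)`** (`τ K = τ K' ⇒ K' = (y ⊕ y)⁻¹ K` for some `y`); with `τ = id` this is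
  the old bound.  The orbits of `GL_k` on such `K` are the isomorphism classes of Kronecker modules
  `K ⇉ 𝔽_p^k` (the two projections, jointly injective) — finitely many families indexed by partitions and
  closed points of `ℙ¹`, `≈ c_k · p^k` classes in all (Kronecker 1890), the true order of the count
  (`Σ_{j≤k} #Irr(GL_j(𝔽_p))` for `m ≥ 2k`); e.g. `p + 3` classes at `k = 1` (truth `p`,
  `LevelOneClassification`), `p² + 4p + 9` at `k = 2` (truth `p² + p − 1`, numerics in ORACLE-g11 §G11-5b).
* `no_witness_of_classes` — the corresponding no-go: no level-`k` witness of the crux in any `GL_m(𝔽_p)`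
  once `(#classes)^ε ≤ 2^{(2+ε)/3}`.

Sorry-free; standard axioms.  VALUE = theorem (structural constraint), NOT summit progress. -/

set_option linter.dupNamespace false

open scoped BigOperators Classical Matrix

namespace Summit.MatrixMultiplication.MatrixMultiplication.Theorems.SubgroupIdentityDesigns.Negative
namespace LevelOrbitCount

open Literature.RepresentationTheory.FiniteGroups
open Literature.Barriers.MatrixMultiplication (SubgroupTPP)
open Summit.MatrixMultiplication.MatrixMultiplication.Theorems.LieRankDesigns.Negative
open Summit.MatrixMultiplication.MatrixMultiplication.Theorems.LevelOneGL2Designs.Negative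
  (levelSubmodule)
open PackingBridge (coe_levelSubmodule crux_law)
open LevelCount (levelSubmodule_le_span_transport exists_gl_mul_eq_of_ker_iff conjSum_transport_eq
  conjSum_classFun conjSum_mem_span)

variable {p : ℕ} [hp : Fact p.Prime] {m : ℕ}

/-- `ker [U y | A y] = (y ⊕ y)⁻¹ · ker [U | A]` (as a comap). -/
theorem ker_fromCols_mul {k : ℕ} (U A : Matrix (Fin m) (Fin k) (ZMod p))
    (y : Matrix (Fin k) (Fin k) (ZMod p)) :
    LinearMap.ker (Matrix.toLin' (Matrix.fromCols (U * y) (A * y))) =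
      (LinearMap.ker (Matrix.toLin' (Matrix.fromCols U A))).comap
        (Matrix.toLin' (Matrix.fromBlocks y 0 0 y)) := by
  rw [← LinearMap.ker_comp, ← Matrix.toLin'_mul, Matrix.fromCols_mul_fromBlocks]
  simp

/-- A frame transport is blind to a simultaneous right twist of the pair:
`[g (U y) = A y] = [g U = A]` for `y ∈ GL_k`. -/
theorem transport_mul_right {k : ℕ} (U A : Matrix (Fin m) (Fin k) (ZMod p))
    (y : Matrix.GeneralLinearGroup (Fin k) (ZMod p)) :
    (fun g : GLm p m => if (g : Mat p m) * (U * (y : Matrix (Fin k) (Fin k) (ZMod p))) =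
        A * (y : Matrix (Fin k) (Fin k) (ZMod p)) then (1 : ℂ) else 0) =
      fun g : GLm p m => if (g : Mat p m) * U = A then (1 : ℂ) else 0 := by
  funext g
  have hiff : (g : Mat p m) * (U * (y : Matrix (Fin k) (Fin k) (ZMod p))) =
      A * (y : Matrix (Fin k) (Fin k) (ZMod p)) ↔ (g : Mat p m) * U = A := by
    constructor
    · intro h
      calc (g : Mat p m) * U
          = (g : Mat p m) * (U * (y : Matrix (Fin k) (Fin k) (ZMod p))) *
              ((y⁻¹ : Matrix.GeneralLinearGroup (Fin k) (ZMod p)) :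
                Matrix (Fin k) (Fin k) (ZMod p)) := by
            rw [Matrix.mul_assoc, Matrix.mul_assoc, Units.mul_inv, Matrix.mul_one]
        _ = A := by rw [h, Matrix.mul_assoc, Units.mul_inv, Matrix.mul_one]
    · intro h
      rw [← Matrix.mul_assoc, h]
  simp only [hiff]

/-- **LEVEL-`k` CHARACTER COUNT BY KRONECKER CLASSES, UNIFORM IN `m`**: for any classification `τ` of
the subspaces of `𝔽_p^k ⊕ 𝔽_p^k` complete for the diagonal `GL_k`-action,
`#(Irr(GL_m(𝔽_p)) ∩ F_k) ≤ #classes`. -/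
theorem ncard_irr_level_le_classes {k : ℕ} {β : Type}
    (τ : Submodule (ZMod p) (Fin k ⊕ Fin k → ZMod p) → β)
    (hτ : ∀ K K', τ K = τ K' → ∃ y : Matrix.GeneralLinearGroup (Fin k) (ZMod p),
      K' = K.comap (Matrix.toLin'
        (Matrix.fromBlocks (y : Matrix (Fin k) (Fin k) (ZMod p)) 0 0 y))) :
    (irrChars (GLm p m) ∩ levelSet p m k).ncard ≤ Nat.card (Set.range τ) := by
  haveI : Fintype (Submodule (ZMod p) (Fin k ⊕ Fin k → ZMod p)) := Fintype.ofFinite _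
  set T : Matrix (Fin m) (Fin k) (ZMod p) × Matrix (Fin m) (Fin k) (ZMod p) → (GLm p m → ℂ) :=
    fun UA g => if (g : Mat p m) * UA.1 = UA.2 then (1 : ℂ) else 0 with hT
  set cs : (GLm p m → ℂ) → (GLm p m → ℂ) :=
    fun F g => ∑ h : GLm p m, F (h * g * h⁻¹) with hcs
  set κ : Matrix (Fin m) (Fin k) (ZMod p) × Matrix (Fin m) (Fin k) (ZMod p) →
      Submodule (ZMod p) (Fin k ⊕ Fin k → ZMod p) :=
    fun UA => LinearMap.ker (Matrix.toLin' (Matrix.fromCols UA.1 UA.2)) with hκ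
  -- (1) same kernel ⇒ same conjugation-sum (as in `LevelCount`)
  have hkey : ∀ UA UA', κ UA = κ UA' → cs (T UA) = cs (T UA') := by
    rintro ⟨U, A⟩ ⟨U', A'⟩ hK
    have hiff : ∀ v, Matrix.fromCols U A *ᵥ v = 0 ↔ Matrix.fromCols U' A' *ᵥ v = 0 := by
      intro v
      have h := SetLike.ext_iff.mp hK v
      simp only [hκ, LinearMap.mem_ker, Matrix.toLin'_apply] at h
      exact h
    obtain ⟨g₀, hg₀⟩ := exists_gl_mul_eq_of_ker_iff _ _ hiff
    rw [Matrix.mul_fromCols, Matrix.fromCols_ext_iff] at hg₀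
    obtain ⟨rfl, rfl⟩ := hg₀
    simp only [hcs, hT]
    exact (conjSum_transport_eq U A g₀).symm
  -- (1') same CLASS ⇒ same conjugation-sum (right twist by `y ∈ GL_k`)
  have hkeyτ : ∀ UA UA', τ (κ UA) = τ (κ UA') → cs (T UA) = cs (T UA') := by
    rintro ⟨U, A⟩ UA' h
    obtain ⟨y, hy⟩ := hτ _ _ h
    have e1 : κ (U * (y : Matrix (Fin k) (Fin k) (ZMod p)), A * (y : Matrix (Fin k) (Fin k) (ZMod p))) =
        κ UA' := by
      rw [hy]; exact ker_fromCols_mul U A _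
    have e2 : T (U * (y : Matrix (Fin k) (Fin k) (ZMod p)), A * (y : Matrix (Fin k) (Fin k) (ZMod p))) =
        T (U, A) := transport_mul_right U A y
    rw [← e2]
    exact hkey _ _ e1
  -- (2) hence at most `#classes` distinct conjugation-sums of transports
  have hfinτ : (Set.range τ).Finite := Set.finite_range τ
  have hR : (Finset.univ.image fun UA => cs (T UA)).card ≤ Nat.card (Set.range τ) := by
    have hfac : ∀ UA, cs (T UA) = (fun b : β =>
        if h : ∃ UA', τ (κ UA') = b then cs (T h.choose) else 0) (τ (κ UA)) := by
      intro UA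
      have hex : ∃ UA', τ (κ UA') = τ (κ UA) := ⟨UA, rfl⟩
      simp only [dif_pos hex]
      exact hkeyτ UA hex.choose hex.choose_spec.symm
    calc (Finset.univ.image fun UA => cs (T UA)).card
        ≤ ((Finset.univ.image fun UA => τ (κ UA)).image fun b : β =>
            if h : ∃ UA', τ (κ UA') = b then cs (T h.choose) else 0).card := by
          refine Finset.card_le_card fun F hF => ?_
          obtain ⟨UA, _, rfl⟩ := Finset.mem_image.mp hF
          exact Finset.mem_image.mpr ⟨τ (κ UA), Finset.mem_image.mpr ⟨UA, Finset.mem_univ _, rfl⟩,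
            (hfac UA).symm⟩
      _ ≤ (Finset.univ.image fun UA => τ (κ UA)).card := Finset.card_image_le
      _ ≤ hfinτ.toFinset.card := by
          refine Finset.card_le_card fun b hb => ?_
          obtain ⟨UA, _, rfl⟩ := Finset.mem_image.mp hb
          exact hfinτ.mem_toFinset.mpr ⟨κ UA, rfl⟩
      _ = Nat.card (Set.range τ) := by
          rw [← Set.ncard_eq_toFinset_card _ hfinτ, Nat.card_coe_set_eq]
  -- (3) every irreducible level-`k` character lies in the span of those conjugation-sums
  set R : Finset (GLm p m → ℂ) := Finset.univ.image fun UA => cs (T UA) with hRdef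
  have hspan : ∀ χ ∈ irrChars (GLm p m) ∩ levelSet p m k,
      χ ∈ Submodule.span ℂ (↑R : Set (GLm p m → ℂ)) := by
    rintro χ ⟨hχ, hχk⟩
    have hmem : χ ∈ levelSubmodule p m k := by
      rw [← SetLike.mem_coe, coe_levelSubmodule]; exact hχk
    have h1 := conjSum_mem_span (levelSubmodule_le_span_transport hmem)
    have himg : ((fun F : GLm p m → ℂ => fun g : GLm p m => ∑ h : GLm p m, F (h * g * h⁻¹)) ''
        Set.range fun UA : Matrix (Fin m) (Fin k) (ZMod p) × Matrix (Fin m) (Fin k) (ZMod p) =>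
          fun g : GLm p m => if (g : Mat p m) * UA.1 = UA.2 then (1 : ℂ) else 0) ⊆ ↑R := by
      rintro F ⟨F', ⟨UA, rfl⟩, rfl⟩
      rw [hRdef, Finset.coe_image, Finset.coe_univ, Set.image_univ]
      exact ⟨UA, rfl⟩
    have h2 := Submodule.span_mono himg h1
    rw [conjSum_classFun hχ.isCharacter.isClassFun] at h2
    have hc : (Fintype.card (GLm p m) : ℂ) ≠ 0 := Nat.cast_ne_zero.mpr Fintype.card_ne_zero
    have h3 := Submodule.smul_mem _ ((Fintype.card (GLm p m) : ℂ)⁻¹) h2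
    have e : ((Fintype.card (GLm p m) : ℂ)⁻¹ • fun g => (Fintype.card (GLm p m) : ℂ) * χ g) = χ := by
      funext g
      simp only [Pi.smul_apply, smul_eq_mul]
      rw [← mul_assoc, inv_mul_cancel₀ hc, one_mul]
    rwa [e] at h3
  -- (4) linear independence
  have hfin : (irrChars (GLm p m) ∩ levelSet p m k).Finite :=
    (irrChars_finite_holds (GLm p m)).subset Set.inter_subset_left
  letI : Fintype (↥(irrChars (GLm p m) ∩ levelSet p m k)) := hfin.fintype
  have hli : LinearIndependent ℂ (fun χ : (irrChars (GLm p m) ∩ levelSet p m k : Set (GLm p m → ℂ)) =>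
      (χ : GLm p m → ℂ)) :=
    (linearIndependent_irrChars (G := GLm p m)).comp
      (Set.inclusion Set.inter_subset_left) (Set.inclusion_injective _)
  have hle := linearIndependent_le_span_aux' _ hli (↑R : Set (GLm p m → ℂ)) (by
    rintro F ⟨χ, rfl⟩
    exact hspan χ χ.2)
  rw [← Nat.card_coe_set_eq, Nat.card_eq_fintype_card]
  calc Fintype.card (↥(irrChars (GLm p m) ∩ levelSet p m k))
      ≤ Fintype.card (↑R : Set (GLm p m → ℂ)) := hle
    _ = R.card := by simp
    _ ≤ _ := hR

/-- **NO LEVEL-`k` WITNESS IN ANY `GL_m(𝔽_p)` ONCE `(#Kronecker classes)^ε ≤ 2^{(2+ε)/3}`**, for any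
complete classification `τ` as above. -/
theorem no_witness_of_classes {k : ℕ} {ε : ℝ} (hε : 0 < ε) {β : Type}
    (τ : Submodule (ZMod p) (Fin k ⊕ Fin k → ZMod p) → β)
    (hτ : ∀ K K', τ K = τ K' → ∃ y : Matrix.GeneralLinearGroup (Fin k) (ZMod p),
      K' = K.comap (Matrix.toLin'
        (Matrix.fromBlocks (y : Matrix (Fin k) (Fin k) (ZMod p)) 0 0 y)))
    (hthr : (Nat.card (Set.range τ) : ℝ) ^ ε ≤ (2 : ℝ) ^ ((2 + ε) / 3))
    {H₁ H₂ H₃ : Subgroup (GLm p m)} (htpp : SubgroupTPP H₁ H₂ H₃)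
    (hdes : ∃ c : Mat p m → ℂ, (∀ M, k < M.rank → c M = 0) ∧
      (∑ M, c M * ZMod.stdAddChar (Matrix.trace (M * ((1 : GLm p m) : Mat p m)))) = 1 ∧
      ∀ a ∈ H₁, ∀ b ∈ H₂, ∀ g ∈ H₃, a * b * g ≠ 1 →
        (∑ M, c M * ZMod.stdAddChar
          (Matrix.trace (M * ((a * b * g : GLm p m) : Mat p m)))) = 0) :
    ¬ budget p m k (2 + ε) <
      ((Nat.card H₁ * Nat.card H₂ * Nat.card H₃ : ℕ) : ℝ) ^ ((2 + ε) / 3) := by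
  intro hlt
  have h := crux_law hε htpp hdes hlt
  have hN : ((irrChars (GLm p m) ∩ levelSet p m k).ncard : ℝ) ≤ (Nat.card (Set.range τ) : ℝ) := by
    exact_mod_cast ncard_irr_level_le_classes (p := p) (m := m) τ hτ
  have h2 := Real.rpow_le_rpow (Nat.cast_nonneg _) hN hε.le
  linarith

/-- Sanity: the identity classification is complete (`y = 1`), so `ncard_irr_level_le_classes`
contains `LevelCount.ncard_irr_level_le`. -/
theorem id_complete {k : ℕ} (K K' : Submodule (ZMod p) (Fin k ⊕ Fin k → ZMod p)) (h : K = K') :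
    ∃ y : Matrix.GeneralLinearGroup (Fin k) (ZMod p),
      K' = K.comap (Matrix.toLin' (Matrix.fromBlocks (y : Matrix (Fin k) (Fin k) (ZMod p)) 0 0 y)) := by
  refine ⟨1, ?_⟩
  subst h
  simp only [Units.val_one, Matrix.fromBlocks_one, Matrix.toLin'_one]
  exact (Submodule.comap_id K).symm

end LevelOrbitCount
end Summit.MatrixMultiplication.MatrixMultiplication.Theorems.SubgroupIdentityDesigns.Negative
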